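import Summits.ResolutionOfSingularities.ResolutionOfSingularities.Theorems.TightDefectStrongWalks
import Literature.AlgebraicGeometry.Resolution.HasseSchmidtDiffEqDiffOp
import HarnessLib

/-!
# ConeCutAxisLaw — the support form of isolation (lens-3 g15 «AxisLaw», ConeCut rev 5 §C⁵ kernel)

Landed VERBATIM (namespace renamed `…Theses.MaxContactCut.ConeCutAxis` ↦ `…Theorems.ConeCutAxisLaw`, `set_option` dropped)
from HOME/decomp-res-lens-3/g15/parts/AxisLaw-rev5-a28bef61.lean (sha256 a28bef61…) by decomp-res writer g6; critic order
2026-08-30T17:40:15Z (rows 105/110 rider: ConeCut §C⁵ keeps only LAW I importing this unit).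
# AxisLaw — the ISOLATION law refined to supports (lens-3 g15, rev 5 add-on to NODE «ConeCut»)

The tree's `pair_lt_of_isolatedTop` reads isolation of the origin in the top locus `V(J_F)` only through a MONOMIAL
FACTOR `u_i^a u_j^b ∣ F`, `a + b ≥ q`.  The engine (`sim/orbit.py`, SEED-g16 §2) shows that what actually kills the tame
mixed plateau words is the SUPPORT form of the same law: the `u_k`-axis lies in the top locus as soon as EVERY monomial
`u^m` of `F` has `m_i + m_j ≥ q` (`{i,j,k} = {0,1,2}`), i.e. `F ∈ (u_i,u_j)^{q}`-by-support — e.g. `F = u^r · G` with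
`r_i + r_j = q − 1` and `G` WITHOUT pure `u_k`-powers (which is forced right after an untranslated repeat, since the
initial form of the previous residual is a pure power of the third variable).  We type and PROVE:

* `hasseDeriv_mem_span_pair_of_support` — `(∀ m ∈ supp F, q ≤ m i + m j) → |γ| < q → ∂^{(γ)} F ∈ (u_i, u_j)`;
* `not_isolatedTop_of_support_pair` — then the origin is NOT an isolated top point (three variables);
* `exists_support_pair_lt_of_isolatedTop` — **AXIS LAW**: at an isolated top point, for every pair `i ≠ j` some
  monomial of `F` has `m_i + m_j < q`;
* `ForcedWalk.axis_law` — along a forced walk, at every stage and for every pair.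

All [folklore]; port-free; sorry-free.  (Sources: BierstoneGrigorievMilmanWlodarczyk2011 Def. 3.1.3 (isolated top
points); Villamayor 2008 §2.6 (order via Hasse–Schmidt derivatives); EGA IV₄ 16.11.2 (binomial formula).)
-/


namespace Summit.ResolutionOfSingularities.ResolutionOfSingularities.Theorems.ConeCutAxisLaw

open MvPolynomial
open Literature.AlgebraicGeometry.Resolution
open Literature.AlgebraicGeometry.Resolution.PointBlowup
open Summit.ResolutionOfSingularities.ResolutionOfSingularities.Theorems.TightDefectClasses
open Summit.ResolutionOfSingularities.ResolutionOfSingularities.Theorems.TightDefectStrongWalks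

variable {σ : Type} {K : Type} [Field K]

/-- Hasse derivatives of order `< q` of a polynomial all of whose monomials `u^m` have `m_i + m_j ≥ q` (`i ≠ j`) lie
in the ideal `(u_i, u_j)` (binomial formula monomial by monomial: `u^{m−γ}` keeps a factor `u_i` or `u_j`).
[folklore] -/
theorem hasseDeriv_mem_span_pair_of_support [DecidableEq σ] {F : MvPolynomial σ K} {i j : σ} (hij : i ≠ j) {q : ℕ}
    (hF : ∀ m ∈ F.support, q ≤ m i + m j) (γ : σ →₀ ℕ) (hγ : γ.degree < q) :
    hasseDeriv K γ F ∈ Ideal.span ({X i, X j} : Set (MvPolynomial σ K)) := by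
  set P : Ideal (MvPolynomial σ K) := Ideal.span ({X i, X j} : Set (MvPolynomial σ K)) with hP
  have hXi : (X i : MvPolynomial σ K) ∈ P := Ideal.subset_span (by simp)
  have hXj : (X j : MvPolynomial σ K) ∈ P := Ideal.subset_span (by simp)
  rw [F.as_sum, map_sum]
  refine Ideal.sum_mem _ fun m hm => ?_
  by_cases hle : γ ≤ m
  · rw [hasseDeriv_monomial]
    refine Ideal.mul_mem_left _ _ ?_
    -- `(m - γ) i ≥ 1` or `(m - γ) j ≥ 1`
    have hq := hF m hm
    have hij' : ¬ (m i ≤ γ i ∧ m j ≤ γ j) := by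
      rintro ⟨h1, h2⟩
      have hle2 : Finsupp.single i (m i) + Finsupp.single j (m j) ≤ γ := by
        refine Finsupp.le_def.mpr fun l => ?_
        rw [Finsupp.add_apply, Finsupp.single_apply, Finsupp.single_apply]
        by_cases hli : i = l
        · subst hli
          rw [if_pos rfl, if_neg (Ne.symm hij), add_zero]; exact h1
        · rw [if_neg hli, zero_add]
          by_cases hlj : j = l
          · subst hlj; rw [if_pos rfl]; exact h2
          · rw [if_neg hlj]; exact Nat.zero_le _
      have hdeg : (Finsupp.single i (m i) + Finsupp.single j (m j)).degree = m i + m j := by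
        rw [map_add, Finsupp.degree_single, Finsupp.degree_single]
      have hmono : (Finsupp.single i (m i) + Finsupp.single j (m j)).degree ≤ γ.degree := by
        have h := add_tsub_cancel_of_le hle2
        calc (Finsupp.single i (m i) + Finsupp.single j (m j)).degree
            ≤ (Finsupp.single i (m i) + Finsupp.single j (m j)).degree +
                (γ - (Finsupp.single i (m i) + Finsupp.single j (m j))).degree := Nat.le_add_right _ _
          _ = ((Finsupp.single i (m i) + Finsupp.single j (m j)) +
                (γ - (Finsupp.single i (m i) + Finsupp.single j (m j)))).degree := (map_add Finsupp.degree _ _).symm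
          _ = γ.degree := by rw [h]
      omega
    rcases not_and_or.mp hij' with h1 | h2
    · have hexp : m - γ = Finsupp.single i 1 + (m - γ - Finsupp.single i 1) := by
        ext l
        simp only [Finsupp.coe_add, Pi.add_apply, Finsupp.coe_tsub, Pi.sub_apply, Finsupp.single_apply]
        by_cases hli : i = l
        · subst hli; rw [if_pos rfl]; omega
        · rw [if_neg hli]; omega
      have : monomial (m - γ) (coeff m F) = X i * monomial (m - γ - Finsupp.single i 1) (coeff m F) := by
        rw [X, monomial_mul, one_mul, ← hexp]
      rw [this]; exact Ideal.mul_mem_right _ _ hXi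
    · have hexp : m - γ = Finsupp.single j 1 + (m - γ - Finsupp.single j 1) := by
        ext l
        simp only [Finsupp.coe_add, Pi.add_apply, Finsupp.coe_tsub, Pi.sub_apply, Finsupp.single_apply]
        by_cases hlj : j = l
        · subst hlj; rw [if_pos rfl]; omega
        · rw [if_neg hlj]; omega
      have : monomial (m - γ) (coeff m F) = X j * monomial (m - γ - Finsupp.single j 1) (coeff m F) := by
        rw [X, monomial_mul, one_mul, ← hexp]
      rw [this]; exact Ideal.mul_mem_right _ _ hXj
  · rw [hasseDeriv_monomial_eq_zero_of_not_le (R := K) hle]; exact P.zero_mem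

/-- Hence the whole top-locus ideal lies in `(u_i, u_j)`. [folklore] -/
theorem topIdeal_le_span_pair_of_support [DecidableEq σ] {F : MvPolynomial σ K} {i j : σ} (hij : i ≠ j) {q : ℕ}
    (hF : ∀ m ∈ F.support, q ≤ m i + m j) :
    topIdeal q F ≤ Ideal.span ({X i, X j} : Set (MvPolynomial σ K)) := by
  refine Ideal.span_le.mpr ?_
  rintro _ ⟨γ, ⟨_, hγ⟩, rfl⟩
  exact hasseDeriv_mem_span_pair_of_support hij hF γ hγ

/-- **No isolation across a heavy pair, SUPPORT FORM**: if every monomial of `F` has `m_i + m_j ≥ q` and there is a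
third variable `u_k`, the origin is NOT an isolated top point (the `u_k`-axis lies in the top locus). [folklore] -/
theorem not_isolatedTop_of_support_pair [DecidableEq σ] {F : MvPolynomial σ K} {i j k : σ} (hij : i ≠ j)
    (hki : k ≠ i) (hkj : k ≠ j) {q : ℕ} (hF : ∀ m ∈ F.support, q ≤ m i + m j) : ¬ IsolatedTop q F := by
  classical
  rintro ⟨N, g, hg0, hg⟩
  let ψ : MvPolynomial σ K →ₐ[K] MvPolynomial σ K := aeval fun l => if l = k then X k else 0
  have hψi : ψ (X i) = 0 := by simp [ψ, if_neg (Ne.symm hki)]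
  have hψj : ψ (X j) = 0 := by simp [ψ, if_neg (Ne.symm hkj)]
  have hψk : ψ (X k) = X k := by simp [ψ]
  have hker : Ideal.span ({X i, X j} : Set (MvPolynomial σ K)) ≤ RingHom.ker ψ.toRingHom := by
    refine Ideal.span_le.mpr ?_
    intro y hy
    simp only [Set.mem_insert_iff, Set.mem_singleton_iff] at hy
    rcases hy with rfl | rfl
    · simpa [RingHom.mem_ker] using hψi
    · simpa [RingHom.mem_ker] using hψj
  have h1 : ψ g * X k ^ N = 0 := by
    have := hker (topIdeal_le_span_pair_of_support hij hF (hg k))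
    rw [RingHom.mem_ker] at this
    simpa [map_mul, map_pow, hψk] using this
  have h2 : ψ g = 0 := by
    rcases mul_eq_zero.mp h1 with h | h
    · exact h
    · exact absurd h (pow_ne_zero _ (X_ne_zero k))
  have h3 : constantCoeff (ψ g) = constantCoeff g := by
    have hcomp : (constantCoeff : MvPolynomial σ K →+* K).comp ψ.toRingHom = constantCoeff := by
      refine MvPolynomial.ringHom_ext (fun c => ?_) (fun l => ?_)
      · simp [ψ]
      · by_cases h : l = k
        · subst h; simp [hψk]
        · simp [ψ, if_neg h]
    exact RingHom.congr_fun hcomp g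
  exact hg0 (by rw [← h3, h2, map_zero])

/-- **AXIS LAW (|σ| = 3)**: at an ISOLATED top point, for every pair `i ≠ j` SOME monomial `u^m` of `F` has
`m_i + m_j < q` — the order of `F` along the third axis is `< q`.  Refines the tree's `pair_lt_of_isolatedTop`
(monomial-factor form). [folklore] -/
theorem exists_support_pair_lt_of_isolatedTop [DecidableEq K] {F : MvPolynomial (Fin 3) K} {q : ℕ}
    (h : IsolatedTop q F) (i j : Fin 3) (hij : i ≠ j) : ∃ m ∈ F.support, m i + m j < q := by
  classical
  have aux : ∀ i j : Fin 3, i ≠ j → ∃ k : Fin 3, k ≠ i ∧ k ≠ j := by decide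
  obtain ⟨k, hki, hkj⟩ := aux i j hij
  by_contra hcon
  push Not at hcon
  exact not_isolatedTop_of_support_pair hij hki hkj hcon h

/-- **AXIS LAW along a forced walk**: at every stage `t` and for every pair `i ≠ j`, some monomial of `F_t` has
`m_i + m_j < q`. [folklore] -/
theorem axis_law [DecidableEq K] {q : ℕ} {s₀ : State (Fin 3) K} (W : ForcedWalk q s₀) (t : ℕ) (i j : Fin 3)
    (hij : i ≠ j) : ∃ m ∈ (W.st t).F.support, m i + m j < q :=
  exists_support_pair_lt_of_isolatedTop (W.isolated t) i j hij

end Summit.ResolutionOfSingularities.ResolutionOfSingularities.Theorems.ConeCutAxisLaw
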